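import Mathlib.Analysis.SpecialFunctions.Log.Basic
import Mathlib.Analysis.SpecialFunctions.Pow.Real
import Mathlib.Analysis.PSeries
import Mathlib.Analysis.Normed.Group.InfiniteSum
import Mathlib.Algebra.BigOperators.Intervals
import Mathlib.Data.Int.Interval
import HarnessLib

/-!
# Elementary sums for the renormalisation of `1/|x-y|²` percolation on `ℤ`

Topic `Literature/Probability/Percolation`. The real-variable estimates used in the proof of the
existence of a transition for one-dimensional `1/|x-y|²` percolation after Duminil-Copin,
Garban and Tassion (*Long-range models in 1D revisited*, AIHP 60 (2024), arXiv:2011.04642,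
§2.3, proof of Lemma 2, display (2.8) and the choice of `C₀`), isolated from the percolation
set-up so that the probabilistic files only quote them:

* `log_sub_one_le_pairSum` — the double harmonic-type sum
  `Λ_N = Σ_{m,m' < N} 1/(3+m+m')²` (written out, no new definition) is at least `log((N+3)/3) - 1` (two telescoping sums and
  `log(1+t) ≤ t`); this is the discrete form of DGT's
  `∫∫_{0 ≤ x,y ≤ A} dx dy/(c+x+y)² ≳ log A`;
* `sq_mul_pairSum_le_blockSum` — if `S ⊇ S_m` and `T ⊇ T_{m'}` (`m, m' < N`) with
  `S_m ⊆ [K(i-3-2m), K(i-1-2m))`, `T_{m'} ⊆ [K(i+1+2m'), K(i+3+2m'))` of sizes `≥ 2θK`, then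
  `θ² Λ_N ≤ Σ_{x ∈ S, y ∈ T} 1/(y-x)²` (DGT (2.8): "Using that `|𝐂⁻|, |𝐂⁺| ≥ A` together with
  (2.7), we find …", here organised block by block);
* `sum_le_mul_sum_image_of_card_fiber_le` — `Σ_{i ∈ s} g(φ i) ≤ k · Σ_{b ∈ φ(s)} g b` when the
  fibres of `φ` on `s` have at most `k` elements (`g ≥ 0`);
* `exists_forall_sum_rpow_neg_le` — tails of `Σ m^{-γ}`, `γ > 1`: for every `ε > 0` there is
  `M` with `Σ_{m ∈ t} m^{-γ} ≤ ε` for every finite set `t` of integers `≥ M` (the choice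
  "provided `C₀` is large enough" before (2.9)).

## References

* H. Duminil-Copin, C. Garban, V. Tassion, *Long-range models in 1D revisited*, AIHP 60 (2024)
  232–241, arXiv:2011.04642: §2.3, proof of Lemma 2 ((2.7)–(2.9)).
-/

noncomputable section

namespace Literature.Probability.Percolation

open Finset Real

/-! ### The double sum `Λ_N` -/

/-- **`log((N+3)/3) - 1 ≤ Λ_N`.** Proof: `1/a² ≥ 1/a - 1/(a+1)`, so the inner sum telescopes to
`≥ 1/(3+m) - 1/(3+m+N) ≥ 1/(3+m) - 1/(3+N)`; then `Σ_{m<N} 1/(3+m) ≥ Σ log((4+m)/(3+m)) =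
log((3+N)/3)` and `Σ_{m<N} 1/(3+N) ≤ 1`.
[cite: DuminilcopinGarbanTassion2024, §2.3 (proof of Lemma 2, (2.8))] -/
theorem log_sub_one_le_pairSum (N : ℕ) :
    Real.log (((N : ℝ) + 3) / 3) - 1 ≤ ∑ m ∈ range N, ∑ m' ∈ range N, 1 / ((3 : ℝ) + m + m') ^ 2 := by
  have hinner : ∀ m ∈ range N, 1 / ((3 : ℝ) + m) - 1 / ((3 : ℝ) + N) ≤
      ∑ m' ∈ range N, 1 / ((3 : ℝ) + m + m') ^ 2 := by
    intro m _
    have htel : ∑ m' ∈ range N, (1 / ((3 : ℝ) + m + m') - 1 / ((3 : ℝ) + m + (m' + 1 : ℕ))) =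
        1 / ((3 : ℝ) + m) - 1 / ((3 : ℝ) + m + N) := by
      have := Finset.sum_range_sub' (fun k : ℕ => 1 / ((3 : ℝ) + m + k)) N
      simpa using this
    have hmono : 1 / ((3 : ℝ) + m + N) ≤ 1 / ((3 : ℝ) + N) :=
      one_div_le_one_div_of_le (by positivity) (by linarith [(Nat.cast_nonneg m : (0 : ℝ) ≤ m)])
    calc 1 / ((3 : ℝ) + m) - 1 / ((3 : ℝ) + N)
        ≤ 1 / ((3 : ℝ) + m) - 1 / ((3 : ℝ) + m + N) := by linarith
      _ = ∑ m' ∈ range N, (1 / ((3 : ℝ) + m + m') - 1 / ((3 : ℝ) + m + (m' + 1 : ℕ))) := htel.symm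
      _ ≤ ∑ m' ∈ range N, 1 / ((3 : ℝ) + m + m') ^ 2 := by
          refine sum_le_sum fun m' _ => ?_
          have ha : (0 : ℝ) < 3 + m + m' := by positivity
          push_cast
          rw [div_sub_div _ _ ha.ne' (by positivity), div_le_div_iff₀ (by positivity) (by positivity)]
          nlinarith
  have hlog : ∀ m ∈ range N,
      Real.log ((3 : ℝ) + ((m + 1 : ℕ) : ℝ)) - Real.log ((3 : ℝ) + m) ≤ 1 / ((3 : ℝ) + m) := by
    intro m _
    have h3 : (0 : ℝ) < 3 + m := by positivity
    have e : (3 : ℝ) + ((m + 1 : ℕ) : ℝ) = 4 + m := by push_cast; ring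
    rw [e, ← Real.log_div (by positivity) h3.ne']
    have := Real.log_le_sub_one_of_pos (show (0 : ℝ) < (4 + m) / (3 + m) by positivity)
    calc Real.log ((4 + (m : ℝ)) / (3 + m)) ≤ (4 + (m : ℝ)) / (3 + m) - 1 := this
      _ = 1 / (3 + (m : ℝ)) := by field_simp; ring
  have htel2 : ∑ m ∈ range N, (Real.log ((3 : ℝ) + ((m + 1 : ℕ) : ℝ)) - Real.log ((3 : ℝ) + m)) =
      Real.log ((3 : ℝ) + N) - Real.log 3 := by
    have := Finset.sum_range_sub (fun k : ℕ => Real.log ((3 : ℝ) + k)) N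
    rw [Nat.cast_zero, add_zero] at this
    exact this
  have hconst : ∑ _m ∈ range N, 1 / ((3 : ℝ) + N) ≤ 1 := by
    rw [sum_const, card_range, nsmul_eq_mul]
    rw [mul_one_div, div_le_one (by positivity)]
    linarith
  calc Real.log (((N : ℝ) + 3) / 3) - 1
      = (Real.log ((3 : ℝ) + N) - Real.log 3) - 1 := by
        rw [Real.log_div (by positivity) (by norm_num), add_comm]
    _ ≤ ∑ m ∈ range N, (Real.log ((3 : ℝ) + ((m + 1 : ℕ) : ℝ)) - Real.log ((3 : ℝ) + m)) -
          ∑ _m ∈ range N, 1 / ((3 : ℝ) + N) := by rw [htel2]; linarith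
    _ ≤ ∑ m ∈ range N, 1 / ((3 : ℝ) + m) - ∑ _m ∈ range N, 1 / ((3 : ℝ) + N) := by
        gcongr with m hm; exact hlog m hm
    _ = ∑ m ∈ range N, (1 / ((3 : ℝ) + m) - 1 / ((3 : ℝ) + N)) := by rw [sum_sub_distrib]
    _ ≤ ∑ m ∈ range N, ∑ m' ∈ range N, 1 / ((3 : ℝ) + m + m') ^ 2 := sum_le_sum hinner

/-! ### From block densities to the interaction sum -/

/-- **Block-by-block lower bound for the interaction sum** (DGT (2.8)): if `S` contains
pairwise-in-distinct-blocks pieces `S_m ⊆ [K(i-3-2m), K(i-1-2m))` and `T` pieces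
`T_{m'} ⊆ [K(i+1+2m'), K(i+3+2m'))`, all of size `≥ 2θK` (`m, m' < N`), then
`θ² Λ_N ≤ Σ_{x ∈ S} Σ_{y ∈ T} 1/(y - x)²`, because a pair in `S_m × T_{m'}` is at distance
`≤ 2K(3+m+m')` and there are `≥ (2θK)²` such pairs.
[cite: DuminilcopinGarbanTassion2024, §2.3 (proof of Lemma 2, (2.7)–(2.8))] -/
theorem sq_mul_pairSum_le_blockSum {K N : ℕ} (hK : 1 ≤ K) {θ : ℝ} (hθ : 0 ≤ θ) (i : ℤ)
    {S T : Finset ℤ} (Sm Tm : ℕ → Finset ℤ)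
    (hSm : ∀ m < N, Sm m ⊆ S ∩ Finset.Ico ((K : ℤ) * (i - 3 - 2 * m)) ((K : ℤ) * (i - 1 - 2 * m)))
    (hTm : ∀ m < N, Tm m ⊆ T ∩ Finset.Ico ((K : ℤ) * (i + 1 + 2 * m)) ((K : ℤ) * (i + 3 + 2 * m)))
    (hScard : ∀ m < N, 2 * θ * K ≤ ((Sm m).card : ℝ)) (hTcard : ∀ m < N, 2 * θ * K ≤ ((Tm m).card : ℝ)) :
    θ ^ 2 * ∑ m ∈ range N, ∑ m' ∈ range N, 1 / ((3 : ℝ) + m + m') ^ 2 ≤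
      ∑ x ∈ S, ∑ y ∈ T, 1 / ((y : ℝ) - x) ^ 2 := by
  have hK0 : (0 : ℝ) < K := by exact_mod_cast hK
  set U := (range N).biUnion Sm with hU
  set V := (range N).biUnion Tm with hV
  have hUS : U ⊆ S := by
    intro x hx
    obtain ⟨m, hm, hxm⟩ := mem_biUnion.1 hx
    exact (mem_inter.1 (hSm m (mem_range.1 hm) hxm)).1
  have hVT : V ⊆ T := by
    intro y hy
    obtain ⟨m, hm, hym⟩ := mem_biUnion.1 hy
    exact (mem_inter.1 (hTm m (mem_range.1 hm) hym)).1
  have hSdisj : ((range N : Finset ℕ) : Set ℕ).PairwiseDisjoint Sm := by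
    intro m hm m' hm' hne
    rw [Function.onFun, Finset.disjoint_left]
    intro x hx hx'
    have h1 := (mem_Ico.1 (mem_inter.1 (hSm m (mem_range.1 hm) hx)).2)
    have h2 := (mem_Ico.1 (mem_inter.1 (hSm m' (mem_range.1 hm') hx')).2)
    rcases lt_or_gt_of_ne hne with h | h
    · have : (m : ℤ) + 1 ≤ m' := by exact_mod_cast h
      nlinarith [h1.1, h2.2, this]
    · have : (m' : ℤ) + 1 ≤ m := by exact_mod_cast h
      nlinarith [h1.2, h2.1, this]
  have hTdisj : ((range N : Finset ℕ) : Set ℕ).PairwiseDisjoint Tm := by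
    intro m hm m' hm' hne
    rw [Function.onFun, Finset.disjoint_left]
    intro x hx hx'
    have h1 := (mem_Ico.1 (mem_inter.1 (hTm m (mem_range.1 hm) hx)).2)
    have h2 := (mem_Ico.1 (mem_inter.1 (hTm m' (mem_range.1 hm') hx')).2)
    rcases lt_or_gt_of_ne hne with h | h
    · have : (m : ℤ) + 1 ≤ m' := by exact_mod_cast h
      nlinarith [h1.2, h2.1, this]
    · have : (m' : ℤ) + 1 ≤ m := by exact_mod_cast h
      nlinarith [h1.1, h2.2, this]
  -- termwise bound on a pair of pieces
  have hterm : ∀ m < N, ∀ m' < N, ∀ x ∈ Sm m, ∀ y ∈ Tm m',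
      1 / (4 * (K : ℝ) ^ 2 * ((3 : ℝ) + m + m') ^ 2) ≤ 1 / ((y : ℝ) - x) ^ 2 := by
    intro m hm m' hm' x hx y hy
    have h1 := (mem_Ico.1 (mem_inter.1 (hSm m hm hx)).2)
    have h2 := (mem_Ico.1 (mem_inter.1 (hTm m' hm' hy)).2)
    have hpos : (0 : ℝ) < (y : ℝ) - x := by
      have : x < y := by nlinarith [h1.2, h2.1, Int.natCast_nonneg K]
      have : (x : ℝ) < y := by exact_mod_cast this
      linarith
    have hle : (y : ℝ) - x ≤ 2 * K * ((3 : ℝ) + m + m') := by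
      have : y - x ≤ (K : ℤ) * (6 + 2 * m + 2 * m') := by nlinarith [h1.1, h2.2]
      have : ((y : ℝ) - x) ≤ (K : ℝ) * (6 + 2 * m + 2 * m') := by exact_mod_cast this
      linarith
    rw [show 4 * (K : ℝ) ^ 2 * ((3 : ℝ) + m + m') ^ 2 = (2 * K * ((3 : ℝ) + m + m')) ^ 2 by ring]
    exact one_div_le_one_div_of_le (by positivity) (pow_le_pow_left₀ hpos.le hle 2)
  calc θ ^ 2 * ∑ m ∈ range N, ∑ m' ∈ range N, 1 / ((3 : ℝ) + m + m') ^ 2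
      = ∑ m ∈ range N, ∑ m' ∈ range N, (2 * θ * K) * (2 * θ * K) *
          (1 / (4 * (K : ℝ) ^ 2 * ((3 : ℝ) + m + m') ^ 2)) := by
        rw [mul_sum]
        refine sum_congr rfl fun m _ => ?_
        rw [mul_sum]
        refine sum_congr rfl fun m' _ => ?_
        field_simp
        ring
    _ ≤ ∑ m ∈ range N, ∑ m' ∈ range N, ((Sm m).card : ℝ) * ((Tm m').card : ℝ) *
          (1 / (4 * (K : ℝ) ^ 2 * ((3 : ℝ) + m + m') ^ 2)) := by
        refine sum_le_sum fun m hm => sum_le_sum fun m' hm' => ?_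
        refine mul_le_mul_of_nonneg_right ?_ (by positivity)
        exact mul_le_mul (hScard m (mem_range.1 hm)) (hTcard m' (mem_range.1 hm')) (by positivity)
          (Nat.cast_nonneg _)
    _ = ∑ m ∈ range N, ∑ m' ∈ range N, ∑ _x ∈ Sm m, ∑ _y ∈ Tm m',
          (1 / (4 * (K : ℝ) ^ 2 * ((3 : ℝ) + m + m') ^ 2)) := by
        refine sum_congr rfl fun m _ => sum_congr rfl fun m' _ => ?_
        rw [sum_const, sum_const, nsmul_eq_mul, nsmul_eq_mul]; ring
    _ ≤ ∑ m ∈ range N, ∑ m' ∈ range N, ∑ x ∈ Sm m, ∑ y ∈ Tm m', 1 / ((y : ℝ) - x) ^ 2 := by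
        refine sum_le_sum fun m hm => sum_le_sum fun m' hm' => sum_le_sum fun x hx =>
          sum_le_sum fun y hy => ?_
        exact hterm m (mem_range.1 hm) m' (mem_range.1 hm') x hx y hy
    _ = ∑ x ∈ U, ∑ y ∈ V, 1 / ((y : ℝ) - x) ^ 2 := by
        rw [hU, sum_biUnion hSdisj]
        refine sum_congr rfl fun m _ => ?_
        rw [sum_comm]
        refine sum_congr rfl fun x _ => ?_
        rw [hV, sum_biUnion hTdisj]
    _ ≤ ∑ x ∈ S, ∑ y ∈ V, 1 / ((y : ℝ) - x) ^ 2 :=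
        sum_le_sum_of_subset_of_nonneg hUS fun _ _ _ => sum_nonneg fun _ _ => by positivity
    _ ≤ ∑ x ∈ S, ∑ y ∈ T, 1 / ((y : ℝ) - x) ^ 2 :=
        sum_le_sum fun x _ => sum_le_sum_of_subset_of_nonneg hVT fun _ _ _ => by positivity

/-! ### Counting fibres and tails of `Σ m^{-γ}` -/

/-- `Σ_{i ∈ s} g (φ i) ≤ k · Σ_{b ∈ φ(s)} g b` for `g ≥ 0` when every fibre of `φ` on `s` has at
most `k` elements. [folklore] -/
theorem sum_le_mul_sum_image_of_card_fiber_le {ι κ : Type*} [DecidableEq κ] (s : Finset ι)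
    (φ : ι → κ) (g : κ → ℝ) (hg : ∀ b, 0 ≤ g b) (k : ℕ)
    (hk : ∀ b ∈ s.image φ, (s.filter fun a => φ a = b).card ≤ k) :
    ∑ a ∈ s, g (φ a) ≤ k * ∑ b ∈ s.image φ, g b := by
  rw [Finset.sum_comp, mul_sum]
  refine sum_le_sum fun b hb => ?_
  rw [nsmul_eq_mul]
  exact mul_le_mul_of_nonneg_right (by exact_mod_cast hk b hb) (hg b)

/-- **Tails of the `γ`-series**: for `γ > 1` and `ε > 0` there is `M` such that
`Σ_{m ∈ t} m^{-γ} ≤ ε` for every finite set `t ⊆ ℕ` of numbers `≥ M` (Cauchy criterion for the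
summable series `Σ m^{-γ}`). [folklore] -/
theorem exists_forall_sum_rpow_neg_le {γ : ℝ} (hγ : 1 < γ) {ε : ℝ} (hε : 0 < ε) :
    ∃ M : ℕ, ∀ t : Finset ℕ, (∀ m ∈ t, M ≤ m) → ∑ m ∈ t, (m : ℝ) ^ (-γ) ≤ ε := by
  have hsum : Summable fun m : ℕ => (m : ℝ) ^ (-γ) := Real.summable_nat_rpow.2 (by linarith)
  obtain ⟨s, hs⟩ := (summable_iff_vanishing_norm.1 hsum) ε hε
  refine ⟨s.sup id + 1, fun t ht => ?_⟩
  have hdisj : Disjoint t s := by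
    rw [Finset.disjoint_left]
    intro m hmt hms
    have h1 := ht m hmt
    have h2 : m ≤ s.sup id := Finset.le_sup (f := id) hms
    omega
  have h := hs t hdisj
  rw [Real.norm_eq_abs] at h
  exact (le_abs_self _).trans h.le

end Literature.Probability.Percolation

end
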